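import Summits.CriticalPhenomena.CardyFormulaZ2.Theorems.CardyRotToConfR2SymmetryUpgrade.Negative.CruxConsequences

/-!
# Target independence forces boundary contact (structure of admissible chordal families)

By-product of the cdisprove unit on crux `CardyRotToConfR2SymmetryUpgrade`
(stmt-CriticalPhenomena-0698), for its provers and for refuters hunting junk inhabitants of the
typed bundle `IsLocalMarkovChordalFamily`.

**Theorem** (`not_forall_ae_boundaryAvoiding`). A chordal family (`ChordalFamily.IsChordal`) with the
splitting form of locality (`ChordalFamily.IsTargetIndependent`, LSW 2001 Cor. 2.3) cannot be carried,
in every Dobrushin domain, by curves meeting `∂D` only at their two endpoints. Sharper, per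
configuration (`not_ae_boundaryAvoiding_chord`): in every three-marked domain `(D; a, b, b')`, the
law from `a` to `b` or the law from `a` to `b'` charges curves touching `∂D` away from their
endpoints. Reason (`measure_firstContact_eq`): by target independence the point where the curve
FIRST meets the closed arc `[b, b']` has the same law for both targets; a boundary-avoiding curve to
`b` first meets it at `b`, a boundary-avoiding curve to `b'` first meets it at `b' ≠ b`.

Consequences recorded for the crux: every BOUNDARY-AVOIDING candidate family (hyperbolic geodesics =
SLE₀, dilation-invariant rays, interior random curves, SLE_κ-type simple curves for `κ ≤ 4`) fails
the typed bundle through `IsTargetIndependent` alone, independently of restriction locality and of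
the Markov property; and any admissible family touches the boundary arc `(b, b']` before terminating
with probability equal to the probability that the `b'`-curve's first contact with `[b, b']` is not
exactly `b` — for atomless first-contact laws, almost surely, for every `b'` ("instant return at the
target", the mirror image of the repair hypothesis (E4) proposed for the start point).
-/

noncomputable section

open Set MeasureTheory Topology Filter
open scoped unitInterval ENNReal NNReal

namespace Summit.CriticalPhenomena.CardyFormulaZ2.Theorems.CardyRotToConfR2SymmetryUpgrade.Negative

open Literature.Probability.RandomPlanarGeometry
open Literature.Probability.RandomPlanarGeometry.ChordalFamily

variable (D : MarkedDomain 3)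

/-- The start point `a` is not on the closed arc `[b, b']` (injectivity of the boundary loop on one
period; `boundary_notMem_arc_one` of `CruxConsequences`). [folklore] -/
theorem pt_zero_notMem_arc_one : D.pt 0 ∉ D.arc 1 :=
  boundary_notMem_arc_one D le_rfl (D.strictMono_mark (by decide : (0 : Fin 3) < 1))

/-- The first-contact point with a closed set `A` of a curve that meets `A`: the target of the
stopped curve, a point of `A` on the trace. [folklore] -/
theorem target_stopAt_mem {A : Set ℂ} (hA : IsClosed A) {c : Curve ℂ} (h : ∃ t, c t ∈ A) :
    (c.stopAt A).target ∈ A ∩ c.range := by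
  rw [Curve.target_stopAt]
  exact ⟨Curve.apply_hitParam_mem hA h, ⟨_, rfl⟩⟩

/-- **Target independence, first-contact form.** In `(D; a, b, b')` the event "the first contact of
the curve with the closed arc `[b, b']` is the point `b`" has the same probability for the law
targeting `b` and the law targeting `b'`. [cite: LawlerSchrammWerner2001, Cor. 2.3] -/
theorem measure_firstContact_eq {P : ChordalFamily} (hT : P.IsTargetIndependent) :
    P (D.chord 0 1 (by decide))
        (CurveClass.stopAt (D.arc 1) ⁻¹' (CurveClass.target ⁻¹' {D.pt 1})) =
      P (D.chord 0 2 (by decide))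
        (CurveClass.stopAt (D.arc 1) ⁻¹' (CurveClass.target ⁻¹' {D.pt 1})) :=
  hT D _ (measurableSet_singleton _ |>.preimage CurveClass.continuous_target.measurable)

/-- A boundary-avoiding curve from `a` to `b` in `(D; a, b, b')` first meets `[b, b']` at `b`.
[folklore] -/
theorem firstContact_eq_pt_one {c : Curve ℂ} (ht : c.target = D.pt 1)
    (hav : c.range ∩ frontier D.carrier ⊆ {D.pt 0, D.pt 1}) :
    (c.stopAt (D.arc 1)).target = D.pt 1 := by
  have hmem := target_stopAt_mem (D.isClosed_arc 1) (c := c) ⟨1, by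
    rw [← Curve.target_def, ht]; exact D.pt_mem_arc_self 1⟩
  rcases hav ⟨hmem.2, D.arc_subset_frontier 1 hmem.1⟩ with h | h
  · exact absurd (h ▸ hmem.1) (pt_zero_notMem_arc_one D)
  · exact h

/-- A boundary-avoiding curve from `a` to `b'` in `(D; a, b, b')` first meets `[b, b']` at `b'`,
not at `b`. [folklore] -/
theorem firstContact_ne_pt_one {c : Curve ℂ} (ht : c.target = D.pt 2)
    (hav : c.range ∩ frontier D.carrier ⊆ {D.pt 0, D.pt 2}) :
    (c.stopAt (D.arc 1)).target ≠ D.pt 1 := by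
  have hmem := target_stopAt_mem (D.isClosed_arc 1) (c := c) ⟨1, by
    rw [← Curve.target_def, ht]
    have := D.pt_succ_mem_arc 1
    exact this⟩
  rcases hav ⟨hmem.2, D.arc_subset_frontier 1 hmem.1⟩ with h | h
  · exact absurd (h ▸ hmem.1) (pt_zero_notMem_arc_one D)
  · rw [h]
    exact fun h12 => absurd (D.pt_injective h12) (by decide)

/-- **In every three-marked domain, the law to `b` or the law to `b'` touches the boundary away
from its endpoints** (chordal + target independent families). [folklore] -/
theorem not_ae_boundaryAvoiding_chord {P : ChordalFamily} (hC : P.IsChordal)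
    (hT : P.IsTargetIndependent) :
    ¬ ((∀ᵐ γ ∂(P (D.chord 0 1 (by decide))),
          γ.range ∩ frontier D.carrier ⊆ {D.pt 0, D.pt 1}) ∧
       (∀ᵐ γ ∂(P (D.chord 0 2 (by decide))),
          γ.range ∩ frontier D.carrier ⊆ {D.pt 0, D.pt 2})) := by
  rintro ⟨h1, h2⟩
  set S : Set (CurveClass ℂ) :=
    CurveClass.stopAt (D.arc 1) ⁻¹' (CurveClass.target ⁻¹' {D.pt 1}) with hS
  have key := measure_firstContact_eq D hT
  -- the law to `b` gives `S` full mass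
  obtain ⟨hprob1, hae1⟩ := hC (D.chord 0 1 (by decide))
  have hfull : P (D.chord 0 1 (by decide)) S = 1 := by
    have hae : ∀ᵐ γ ∂(P (D.chord 0 1 (by decide))), γ ∈ S := by
      filter_upwards [hae1, h1] with γ hγ hav
      obtain ⟨c, rfl⟩ := CurveClass.surjective_mk γ
      obtain ⟨-, ht, -⟩ := hγ
      change CurveClass.stopAt (D.arc 1) (CurveClass.mk c) ∈ CurveClass.target ⁻¹' {D.pt 1}
      rw [CurveClass.stopAt_mk_holds _ (D.isClosed_arc 1), Set.mem_preimage, CurveClass.target_mk,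
        Set.mem_singleton_iff]
      exact firstContact_eq_pt_one D ht hav
    refine le_antisymm prob_le_one ?_
    have hc : P (D.chord 0 1 (by decide)) Sᶜ = 0 := by
      rw [ae_iff] at hae
      exact hae
    have h := measure_union_le (μ := P (D.chord 0 1 (by decide))) S Sᶜ
    rw [Set.union_compl_self, measure_univ, hc, add_zero] at h
    exact h
  -- the law to `b'` gives `S` no mass
  obtain ⟨hprob2, hae2⟩ := hC (D.chord 0 2 (by decide))
  have hnull : P (D.chord 0 2 (by decide)) S = 0 := by
    have hae : ∀ᵐ γ ∂(P (D.chord 0 2 (by decide))), γ ∉ S := by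
      filter_upwards [hae2, h2] with γ hγ hav
      obtain ⟨c, rfl⟩ := CurveClass.surjective_mk γ
      obtain ⟨-, ht, -⟩ := hγ
      change CurveClass.stopAt (D.arc 1) (CurveClass.mk c) ∉ CurveClass.target ⁻¹' {D.pt 1}
      rw [CurveClass.stopAt_mk_holds _ (D.isClosed_arc 1), Set.mem_preimage, CurveClass.target_mk,
        Set.mem_singleton_iff]
      exact firstContact_ne_pt_one D ht hav
    rw [ae_iff] at hae
    simpa using hae
  rw [hfull, hnull] at key
  exact one_ne_zero key

/-- **Target independence forces boundary contact**: a chordal, target independent family is not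
carried, in every Dobrushin domain, by curves meeting `∂D` only at `a` and `b`. (Witness
configuration: the unit disc with three marked points.) [folklore] -/
theorem not_forall_ae_boundaryAvoiding {P : ChordalFamily} (hC : P.IsChordal)
    (hT : P.IsTargetIndependent) :
    ¬ ∀ E : DobrushinDomain, ∀ᵐ γ ∂(P E), γ.range ∩ frontier E.carrier ⊆ {E.pt 0, E.pt 1} := by
  intro h
  set D3 : MarkedDomain 3 :=
    ConformalRectangle.unitDisc.restrictMarks (Fin.castLEOrderEmb (by decide : 3 ≤ 4))
  exact not_ae_boundaryAvoiding_chord D3 hC hT ⟨h (D3.chord 0 1 (by decide)),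
    h (D3.chord 0 2 (by decide))⟩

/-- The same for the crux's hypothesis bundle: an `IsLocalMarkovChordalFamily` is never
boundary-avoiding in every domain. [folklore] -/
theorem not_forall_ae_boundaryAvoiding_of_bundle {P : ChordalFamily}
    (h : IsLocalMarkovChordalFamily P) :
    ¬ ∀ E : DobrushinDomain, ∀ᵐ γ ∂(P E), γ.range ∩ frontier E.carrier ⊆ {E.pt 0, E.pt 1} :=
  not_forall_ae_boundaryAvoiding h.isChordal h.targetIndependent

end Summit.CriticalPhenomena.CardyFormulaZ2.Theorems.CardyRotToConfR2SymmetryUpgrade.Negative
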